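import Mathlib
import Summits.NavierStokesRegularity.NavierStokesRegularity.Theorems.WakeRatchetTailRatchetScalarFrontPositive
import HarnessLib

/-!
# Scalar dyadic fronts (construction `DyadicScalarFronts`, stmt-NavierStokesRegularity-21808):
# the WAKE ZONE is tame — where `|t|·a(t) ≤ 1/(8Λ)` up to the blow-up time, `sup_{[τ,0)} a ≤ 2·a(τ)`

Support file for the crux `WakeRatchet.TailRatchet` (stmt-21808; refuted BY NAME modulo the construction
`WakeRatchetDyadicFront.DyadicScalarFronts`, p589335; MODEL lattice ODEs of Tao 2016 §1.2, §4 — nothing here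
concerns the Navier–Stokes equations, and no item is closed).  A brick of the one remaining a-priori SIZE bound of
programme R-glob (census memo `G2G3-APRIORI-21808-leafhand4-g6.md`): control of the trailing (wake) side.

For a non-negative profile `a` of `a' = (Λ/s²)a(t/s)² − (s/Λ)a(t)a(st)` on `t < 0`, the drain is non-negative,
so on `[τ, 0)` the profile is fed only by values on `[τ/s, 0)`:
* `feed_bound` — if `a ≤ B` on `[τ/s, 0)` then `a(t) ≤ a(τ) + (Λ/s²)|τ|·B²` for `t ∈ [τ, 0)`;
* `le_two_mul_of_bound` — the CLOSED form (`a ≤ B` on `[τ,0)` with `(Λ/s²)|τ|B ≤ 1/2` and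
  `|τ|a(τ) ≤ 1/(4Λ)`) self-improves by iteration `B ↦ a(τ) + B/2` to `a ≤ 2a(τ)` on `[τ, 0)`;
* `wakeZone_le_two_mul` — **wake-zone control**: if `|t|·a(t) ≤ 1/(8Λ)` for all `t ∈ [τ_z, 0)`, then for
  EVERY `τ ∈ [τ_z, 0)`: `a(t) ≤ 2a(τ)` for all `t ∈ [τ, 0)` (small branch of the quadratic inequality,
  propagated outwards rung by rung from the blow-up time, where it holds because `a` is bounded);
* `wake_le_two_mul`, `wakeZone_short` — hence the wake `L = a(0⁻) ≤ 2a(τ)` and `L·|τ| ≤ 1/(4Λ)` on the zone: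
  the wake zone of an admissible front is SHORT (`|τ_z| ≤ 1/(4ΛL)`) and carries action `∫_τ^0 a ≤ 2|τ|a(τ) ≤ 1/(4Λ)`
  (`wakeZone_action_le`).

HONEST FRAMING: elementary real analysis about a MODEL lattice ODE; existence of fronts is NOT proved; the bulk
part of the size bound stays open; nothing about Navier–Stokes.
-/

noncomputable section

set_option linter.dupNamespace false

namespace Summit.NavierStokesRegularity.NavierStokesRegularity.Theorems

namespace WakeRatchetScalarFrontWakeZone

open Filter Topology Set MeasureTheory intervalIntegral
open Literature.Analysis.FluidPDE Literature.Analysis.FluidPDE.TaoCascade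
open WakeRatchetScalarFront WakeRatchetScalarFrontWake WakeRatchetScalarFrontAdmissible
open WakeRatchetScalarFrontPositive

variable {ε₀ s : ℝ} {a : ℝ → ℝ}

/-! ## The feed bound on `[τ, 0)` -/

/-- Continuity of the right-hand side of the front equation on `t < 0`. [elementary] -/
theorem continuousOn_rhs (hs : 0 < s)
    (hode : ∀ t : ℝ, t < 0 → HasDerivAt a
      (bigLam ε₀ / s ^ 2 * a (t / s) ^ 2 - s / bigLam ε₀ * a t * a (s * t)) t) :
    ContinuousOn (fun t => bigLam ε₀ / s ^ 2 * a (t / s) ^ 2 - s / bigLam ε₀ * a t * a (s * t)) (Iio 0) := by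
  have hcont := continuousOn_of_ode hode
  have h1 : ContinuousOn (fun t => a (t / s)) (Iio 0) :=
    hcont.comp (continuous_id.div_const s).continuousOn (fun t ht => div_neg_of_neg_of_pos ht hs)
  have h2 : ContinuousOn (fun t => a (s * t)) (Iio 0) :=
    hcont.comp (continuous_const.mul continuous_id).continuousOn (fun t ht => mul_neg_of_pos_of_neg hs ht)
  exact ((h1.pow 2).const_smul (bigLam ε₀ / s ^ 2)).sub ((hcont.mul h2).const_smul (s / bigLam ε₀)) |>.congr
    (fun t _ => by simp [smul_eq_mul]; ring)

/-- **Feed bound.**  For a non-negative profile: if `a ≤ B` on `[τ/s, 0)` (`τ < 0`), then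
`a(t) ≤ a(τ) + (Λ/s²)·|τ|·B²` for every `t ∈ [τ, 0)` (the drain is non-negative and the feed on `[τ,0)` reads
values on `[τ/s, 0)` only). [cite: Tao2016AveragedNS, §1.2 (dyadic model); elementary] -/
theorem feed_bound (hε : 0 < ε₀) (hs : 1 < s)
    (hode : ∀ t : ℝ, t < 0 → HasDerivAt a
      (bigLam ε₀ / s ^ 2 * a (t / s) ^ 2 - s / bigLam ε₀ * a t * a (s * t)) t)
    (hnn : ∀ t : ℝ, t < 0 → 0 ≤ a t) {τ B : ℝ}
    (hB : ∀ u ∈ Ico (τ / s) 0, a u ≤ B) {t : ℝ} (ht : t ∈ Ico τ 0) :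
    a t ≤ a τ + bigLam ε₀ / s ^ 2 * (-τ) * B ^ 2 := by
  have hs0 : 0 < s := by linarith
  have hΛ : 0 < bigLam ε₀ := bigLam_pos (by linarith)
  have ht0 : t < 0 := ht.2
  have hτt : τ ≤ t := ht.1
  -- FTC on `[τ, t]`
  have hderiv : ∀ u ∈ uIcc τ t, HasDerivAt a
      (bigLam ε₀ / s ^ 2 * a (u / s) ^ 2 - s / bigLam ε₀ * a u * a (s * u)) u := by
    intro u hu
    rw [uIcc_of_le hτt] at hu
    exact hode u (lt_of_le_of_lt hu.2 ht0)
  have hsub : uIcc τ t ⊆ Iio 0 := by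
    rw [uIcc_of_le hτt]; exact fun u hu => lt_of_le_of_lt hu.2 ht0
  have hint : IntervalIntegrable
      (fun u => bigLam ε₀ / s ^ 2 * a (u / s) ^ 2 - s / bigLam ε₀ * a u * a (s * u)) volume τ t :=
    ((continuousOn_rhs hs0 hode).mono hsub).intervalIntegrable
  have hftc := intervalIntegral.integral_eq_sub_of_hasDerivAt hderiv hint
  -- pointwise bound of the integrand by the constant `(Λ/s²) B²`
  have hpt : ∀ u ∈ Icc τ t,
      bigLam ε₀ / s ^ 2 * a (u / s) ^ 2 - s / bigLam ε₀ * a u * a (s * u) ≤ bigLam ε₀ / s ^ 2 * B ^ 2 := by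
    intro u hu
    have hu0 : u < 0 := lt_of_le_of_lt hu.2 ht0
    have hus : u / s ∈ Ico (τ / s) 0 :=
      ⟨by rw [div_le_div_iff_of_pos_right hs0]; exact hu.1, div_neg_of_neg_of_pos hu0 hs0⟩
    have h1 : a (u / s) ^ 2 ≤ B ^ 2 := pow_le_pow_left₀ (hnn _ hus.2) (hB _ hus) 2
    have h2 : 0 ≤ s / bigLam ε₀ * a u * a (s * u) :=
      mul_nonneg (mul_nonneg (div_pos hs0 hΛ).le (hnn u hu0)) (hnn _ (mul_neg_of_pos_of_neg hs0 hu0))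
    have h3 := mul_le_mul_of_nonneg_left h1 (div_pos hΛ (pow_pos hs0 2)).le
    linarith
  have hmono : ∫ u in τ..t, (bigLam ε₀ / s ^ 2 * a (u / s) ^ 2 - s / bigLam ε₀ * a u * a (s * u))
      ≤ ∫ u in τ..t, (bigLam ε₀ / s ^ 2 * B ^ 2 : ℝ) :=
    intervalIntegral.integral_mono_on hτt hint intervalIntegrable_const hpt
  rw [intervalIntegral.integral_const, smul_eq_mul, hftc] at hmono
  have hlen : (t - τ) * (bigLam ε₀ / s ^ 2 * B ^ 2) ≤ (-τ) * (bigLam ε₀ / s ^ 2 * B ^ 2) :=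
    mul_le_mul_of_nonneg_right (by linarith) (by positivity)
  linarith

/-! ## The closed inequality self-improves: `a ≤ 2a(τ)` on `[τ,0)` -/

/-- **Small branch.**  If `a ≤ B` on `[τ, 0)` with `(Λ/s²)|τ|·B ≤ 1/2` and `|τ|·a(τ) ≤ 1/(4Λ)`, then
`a ≤ 2a(τ)` on `[τ, 0)` (iterate `B ↦ a(τ) + B/2`). [cite: Tao2016AveragedNS, §1.2; elementary] -/
theorem le_two_mul_of_bound (hε : 0 < ε₀) (hs : 1 < s)
    (hode : ∀ t : ℝ, t < 0 → HasDerivAt a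
      (bigLam ε₀ / s ^ 2 * a (t / s) ^ 2 - s / bigLam ε₀ * a t * a (s * t)) t)
    (hnn : ∀ t : ℝ, t < 0 → 0 ≤ a t) {τ B : ℝ} (hτ : τ < 0)
    (hB : ∀ u ∈ Ico τ 0, a u ≤ B) (hcB : bigLam ε₀ / s ^ 2 * (-τ) * B ≤ 1 / 2)
    (hg : (-τ) * a τ ≤ 1 / (4 * bigLam ε₀)) :
    ∀ t ∈ Ico τ 0, a t ≤ 2 * a τ := by
  have hs0 : 0 < s := by linarith
  have hΛ : 0 < bigLam ε₀ := bigLam_pos (by linarith)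
  have hs1 : 1 ≤ s ^ 2 := by nlinarith
  have hτs : τ ≤ τ / s := by
    rw [le_div_iff₀ hs0]; nlinarith
  set c : ℝ := bigLam ε₀ / s ^ 2 * (-τ) with hc
  have hc0 : 0 ≤ c := mul_nonneg (div_pos hΛ (pow_pos hs0 2)).le (by linarith)
  -- `c · 2a(τ) ≤ 1/2`
  have hca : c * (2 * a τ) ≤ 1 / 2 := by
    have h1 : c * (2 * a τ) = 2 / s ^ 2 * (bigLam ε₀ * ((-τ) * a τ)) := by rw [hc]; ring
    rw [h1]
    have h2 : bigLam ε₀ * ((-τ) * a τ) ≤ 1 / 4 := by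
      calc bigLam ε₀ * ((-τ) * a τ) ≤ bigLam ε₀ * (1 / (4 * bigLam ε₀)) :=
            mul_le_mul_of_nonneg_left hg hΛ.le
        _ = 1 / 4 := by field_simp
    have h3 : 2 / s ^ 2 ≤ 2 := by
      rw [div_le_iff₀ (by positivity)]; nlinarith
    calc 2 / s ^ 2 * (bigLam ε₀ * ((-τ) * a τ)) ≤ 2 * (1 / 4) :=
          mul_le_mul h3 h2 (mul_nonneg hΛ.le (mul_nonneg (by linarith) (hnn τ hτ))) (by norm_num)
      _ = 1 / 2 := by norm_num
  -- iteration: `a ≤ 2a(τ) + (B − 2a(τ))/2^n` on `[τ, 0)` for every `n`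
  have iter : ∀ n : ℕ, ∀ t ∈ Ico τ 0, a t ≤ 2 * a τ + (B - 2 * a τ) / 2 ^ n := by
    intro n
    induction n with
    | zero => intro t ht; simpa using hB t ht
    | succ n ih =>
      intro t ht
      set Bn : ℝ := 2 * a τ + (B - 2 * a τ) / 2 ^ n with hBn
      -- `c · Bn ≤ 1/2` since `Bn ≤ max B (2a(τ))`
      have hBn_le : Bn ≤ max B (2 * a τ) := by
        rcases le_or_gt (2 * a τ) B with h | h
        · have : (B - 2 * a τ) / 2 ^ n ≤ B - 2 * a τ :=
            div_le_self (by linarith) (one_le_pow₀ (by norm_num : (1:ℝ) ≤ 2))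
          calc Bn ≤ 2 * a τ + (B - 2 * a τ) := by linarith
            _ = B := by ring
            _ ≤ max B (2 * a τ) := le_max_left _ _
        · have : (B - 2 * a τ) / 2 ^ n ≤ 0 :=
            div_nonpos_of_nonpos_of_nonneg (by linarith) (by positivity)
          calc Bn ≤ 2 * a τ := by linarith
            _ ≤ max B (2 * a τ) := le_max_right _ _
      have hcBn : c * Bn ≤ 1 / 2 := by
        rcases le_total B (2 * a τ) with h | h
        · rw [max_eq_right h] at hBn_le
          exact (mul_le_mul_of_nonneg_left hBn_le hc0).trans hca
        · rw [max_eq_left h] at hBn_le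
          exact (mul_le_mul_of_nonneg_left hBn_le hc0).trans hcB
      have hBn0 : 0 ≤ Bn := (hnn t ht.2).trans (ih t ht)
      -- feed bound with the bound `Bn` on `[τ/s, 0) ⊆ [τ, 0)`
      have hfeed := feed_bound hε hs hode hnn (τ := τ) (B := Bn)
        (fun u hu => ih u ⟨hτs.trans hu.1, hu.2⟩) ht
      -- `a t ≤ a τ + c Bn² ≤ a τ + Bn/2`
      have h1 : bigLam ε₀ / s ^ 2 * (-τ) * Bn ^ 2 = (c * Bn) * Bn := by rw [hc]; ring
      rw [h1] at hfeed
      have h2 : (c * Bn) * Bn ≤ (1 / 2) * Bn := mul_le_mul_of_nonneg_right hcBn hBn0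
      have h3 : a τ + (1 / 2) * Bn = 2 * a τ + (B - 2 * a τ) / 2 ^ (n + 1) := by
        rw [hBn, pow_succ]; field_simp; ring
      linarith
  -- pass to the limit `n → ∞`
  intro t ht
  refine le_of_forall_pos_lt_add fun η hη => ?_
  obtain ⟨n, hn⟩ := pow_unbounded_of_one_lt (|B - 2 * a τ| / η) (by norm_num : (1:ℝ) < 2)
  have h2n : (0:ℝ) < 2 ^ n := by positivity
  have hlt : (B - 2 * a τ) / 2 ^ n < η := by
    rw [div_lt_iff₀ h2n]
    rw [div_lt_iff₀ hη] at hn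
    have := le_abs_self (B - 2 * a τ)
    nlinarith
  linarith [iter n t ht]

/-! ## Propagation outwards through the wake zone -/

/-- **One rung outwards.**  If `a ≤ 2a(τ')` on `[τ', 0)` and `τ ∈ [sτ', τ']` lies in the zone
(`|τ|a(τ) ≤ 1/(8Λ)`, `|τ'|a(τ') ≤ 1/(8Λ)`), then `a ≤ 2a(τ)` on `[τ, 0)`. [elementary] -/
theorem step_out (hε : 0 < ε₀) (hs : 1 < s)
    (hode : ∀ t : ℝ, t < 0 → HasDerivAt a
      (bigLam ε₀ / s ^ 2 * a (t / s) ^ 2 - s / bigLam ε₀ * a t * a (s * t)) t)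
    (hnn : ∀ t : ℝ, t < 0 → 0 ≤ a t) {τ τ' : ℝ} (hτ' : τ' < 0) (hττ' : τ ≤ τ') (hsτ : s * τ' ≤ τ)
    (hind : ∀ t ∈ Ico τ' 0, a t ≤ 2 * a τ')
    (hgτ : (-τ) * a τ ≤ 1 / (8 * bigLam ε₀)) (hgτ' : (-τ') * a τ' ≤ 1 / (8 * bigLam ε₀)) :
    ∀ t ∈ Ico τ 0, a t ≤ 2 * a τ := by
  have hs0 : 0 < s := by linarith
  have hΛ : 0 < bigLam ε₀ := bigLam_pos (by linarith)
  have hτ : τ < 0 := lt_of_le_of_lt hττ' hτ'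
  -- new bound on `[τ, 0)` from the feed bound with `B = 2a(τ')` on `[τ/s, 0) ⊆ [τ', 0)`
  have hτs : τ' ≤ τ / s := by rw [le_div_iff₀ hs0]; linarith
  set B' : ℝ := a τ + bigLam ε₀ / s ^ 2 * (-τ) * (2 * a τ') ^ 2 with hB'def
  have hB' : ∀ u ∈ Ico τ 0, a u ≤ B' := fun u hu =>
    feed_bound hε hs hode hnn (τ := τ) (B := 2 * a τ') (fun v hv => hind v ⟨hτs.trans hv.1, hv.2⟩) hu
  -- `(Λ/s²)|τ| B' ≤ 1/2`
  have hcB' : bigLam ε₀ / s ^ 2 * (-τ) * B' ≤ 1 / 2 := by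
    have hs2 : 1 ≤ s ^ 2 := by nlinarith
    have e : bigLam ε₀ / s ^ 2 * (-τ) * B'
        = (1 / s ^ 2) * (bigLam ε₀ * ((-τ) * a τ))
          + (4 / s ^ 4) * (bigLam ε₀ * ((-τ) * a τ')) ^ 2 := by
      rw [hB'def]; field_simp; ring
    have h1 : bigLam ε₀ * ((-τ) * a τ) ≤ 1 / 8 := by
      calc bigLam ε₀ * ((-τ) * a τ) ≤ bigLam ε₀ * (1 / (8 * bigLam ε₀)) := mul_le_mul_of_nonneg_left hgτ hΛ.le
        _ = 1 / 8 := by field_simp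
    have h2 : bigLam ε₀ * ((-τ) * a τ') ≤ s * (1 / 8) := by
      have : (-τ) * a τ' ≤ s * ((-τ') * a τ') := by
        have := hnn τ' hτ'; nlinarith
      calc bigLam ε₀ * ((-τ) * a τ') ≤ bigLam ε₀ * (s * ((-τ') * a τ')) := mul_le_mul_of_nonneg_left this hΛ.le
        _ = s * (bigLam ε₀ * ((-τ') * a τ')) := by ring
        _ ≤ s * (1 / 8) := by
            apply mul_le_mul_of_nonneg_left _ hs0.le
            calc bigLam ε₀ * ((-τ') * a τ') ≤ bigLam ε₀ * (1 / (8 * bigLam ε₀)) :=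
                  mul_le_mul_of_nonneg_left hgτ' hΛ.le
              _ = 1 / 8 := by field_simp
    have h2' : (bigLam ε₀ * ((-τ) * a τ')) ^ 2 ≤ (s * (1 / 8)) ^ 2 :=
      pow_le_pow_left₀ (mul_nonneg hΛ.le (mul_nonneg (by linarith) (hnn τ' hτ'))) h2 2
    rw [e]
    have hA : (1 / s ^ 2) * (bigLam ε₀ * ((-τ) * a τ)) ≤ 1 / 8 := by
      calc (1 / s ^ 2) * (bigLam ε₀ * ((-τ) * a τ)) ≤ 1 * (1 / 8) :=
            mul_le_mul (by rw [div_le_iff₀ (by positivity)]; linarith) h1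
              (mul_nonneg hΛ.le (mul_nonneg (by linarith) (hnn τ hτ))) (by norm_num)
        _ = 1 / 8 := by ring
    have hB : (4 / s ^ 4) * (bigLam ε₀ * ((-τ) * a τ')) ^ 2 ≤ 1 / 16 := by
      calc (4 / s ^ 4) * (bigLam ε₀ * ((-τ) * a τ')) ^ 2
          ≤ (4 / s ^ 4) * (s * (1 / 8)) ^ 2 := mul_le_mul_of_nonneg_left h2' (by positivity)
        _ = 1 / (16 * s ^ 2) := by field_simp; ring
        _ ≤ 1 / 16 := by
            apply div_le_div_of_nonneg_left (by norm_num) (by norm_num) (by nlinarith)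
    linarith
  have hg4 : (-τ) * a τ ≤ 1 / (4 * bigLam ε₀) := by
    have : 1 / (8 * bigLam ε₀) ≤ 1 / (4 * bigLam ε₀) :=
      div_le_div_of_nonneg_left (by norm_num) (by positivity) (by linarith)
    exact hgτ.trans this
  exact le_two_mul_of_bound hε hs hode hnn hτ hB' hcB' hg4

/-- **Wake-zone control.**  For a non-negative profile bounded on `t < 0`: if `|t|·a(t) ≤ 1/(8Λ)` for all
`t ∈ [τ_z, 0)` (`τ_z < 0`), then for every `τ ∈ [τ_z, 0)` and every `t ∈ [τ, 0)`: `a(t) ≤ 2·a(τ)`.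
[cite: Tao2016AveragedNS, §1.2 (dyadic model); elementary] -/
theorem wakeZone_le_two_mul (hε : 0 < ε₀) (hs : 1 < s)
    (hode : ∀ t : ℝ, t < 0 → HasDerivAt a
      (bigLam ε₀ / s ^ 2 * a (t / s) ^ 2 - s / bigLam ε₀ * a t * a (s * t)) t)
    (hnn : ∀ t : ℝ, t < 0 → 0 ≤ a t) {P : ℝ} (hP : ∀ t : ℝ, t < 0 → |a t| ≤ P)
    {τz : ℝ} (hτz : τz < 0) (hzone : ∀ t ∈ Ico τz 0, (-t) * a t ≤ 1 / (8 * bigLam ε₀)) :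
    ∀ τ ∈ Ico τz 0, ∀ t ∈ Ico τ 0, a t ≤ 2 * a τ := by
  have hs0 : 0 < s := by linarith
  have hΛ : 0 < bigLam ε₀ := bigLam_pos (by linarith)
  have hP0 : 0 ≤ P := (abs_nonneg _).trans (hP (-1) (by norm_num))
  have hzone4 : ∀ t ∈ Ico τz 0, (-t) * a t ≤ 1 / (4 * bigLam ε₀) := fun t ht =>
    (hzone t ht).trans (div_le_div_of_nonneg_left (by norm_num) (by positivity) (by linarith))
  -- base: near the blow-up time the closed inequality is in the small branch because `a ≤ P`
  set τ₀ : ℝ := max τz (-(s ^ 2 / (2 * bigLam ε₀ * (P + 1)))) with hτ₀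
  have hτ₀neg : τ₀ < 0 := max_lt hτz (by
    have : 0 < s ^ 2 / (2 * bigLam ε₀ * (P + 1)) := by positivity
    linarith)
  have hτ₀z : τz ≤ τ₀ := le_max_left _ _
  have base : ∀ τ ∈ Ico τ₀ 0, ∀ t ∈ Ico τ 0, a t ≤ 2 * a τ := by
    intro τ hτ
    have hτneg : τ < 0 := hτ.2
    have hB : ∀ u ∈ Ico τ 0, a u ≤ P := fun u hu => (le_abs_self _).trans (hP u hu.2)
    have hcB : bigLam ε₀ / s ^ 2 * (-τ) * P ≤ 1 / 2 := by
      have h1 : -τ ≤ s ^ 2 / (2 * bigLam ε₀ * (P + 1)) := by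
        have := (le_max_right _ _ : -(s ^ 2 / (2 * bigLam ε₀ * (P + 1))) ≤ τ₀)
        linarith [hτ.1]
      calc bigLam ε₀ / s ^ 2 * (-τ) * P ≤ bigLam ε₀ / s ^ 2 * (s ^ 2 / (2 * bigLam ε₀ * (P + 1))) * P := by
            apply mul_le_mul_of_nonneg_right _ hP0
            exact mul_le_mul_of_nonneg_left h1 (by positivity)
        _ = P / (2 * (P + 1)) := by field_simp
        _ ≤ 1 / 2 := by
            rw [div_le_iff₀ (by positivity)]; linarith
    exact le_two_mul_of_bound hε hs hode hnn hτneg hB hcB (hzone4 τ ⟨hτ₀z.trans hτ.1, hτ.2⟩)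
  -- induction outwards along `s^k τ₀`
  have claim : ∀ k : ℕ, ∀ τ ∈ Ico (max τz (s ^ k * τ₀)) 0, ∀ t ∈ Ico τ 0, a t ≤ 2 * a τ := by
    intro k
    induction k with
    | zero =>
      intro τ hτ
      have h0 : τ₀ ≤ τ := by
        have h := hτ.1
        rw [pow_zero, one_mul] at h
        exact (le_max_right _ _).trans h
      exact base τ ⟨h0, hτ.2⟩
    | succ k ih =>
      intro τ hτ t ht
      by_cases hcase : max τz (s ^ k * τ₀) ≤ τ
      · exact ih τ ⟨hcase, hτ.2⟩ t ht
      · push Not at hcase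
        have hτz' : τz ≤ τ := (le_max_left _ _).trans hτ.1
        have hsk : s ^ (k + 1) * τ₀ ≤ τ := (le_max_right _ _).trans hτ.1
        have hτlt : τ < s ^ k * τ₀ := by
          rcases lt_max_iff.1 hcase with h | h
          · exact absurd h (not_lt.2 hτz')
          · exact h
        -- the inner point `τ' = τ/s`
        set τ' : ℝ := τ / s with hτ'
        have hτ'ge : s ^ k * τ₀ ≤ τ' := by
          rw [hτ', le_div_iff₀ hs0]; rw [pow_succ] at hsk; linarith
        have hτ'neg : τ' < 0 := div_neg_of_neg_of_pos hτ.2 hs0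
        have hττ' : τ ≤ τ' := by rw [hτ', le_div_iff₀ hs0]; nlinarith [hτ.2]
        have hτ'z : τz ≤ τ' := hτz'.trans hττ'
        have hind := ih τ' ⟨max_le hτ'z hτ'ge, hτ'neg⟩
        have hsτ : s * τ' ≤ τ := by rw [hτ']; field_simp; exact le_refl _
        exact step_out hε hs hode hnn hτ'neg hττ' hsτ hind (hzone τ ⟨hτz', hτ.2⟩)
          (hzone τ' ⟨hτ'z, hτ'neg⟩) t ht
  intro τ hτ
  -- choose `k` with `s^k τ₀ ≤ τ`
  obtain ⟨k, hk⟩ := pow_unbounded_of_one_lt (τ / τ₀) hs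
  have hk' : s ^ k * τ₀ ≤ τ := by
    have h := (div_lt_iff_of_neg hτ₀neg).1 hk
    linarith
  exact claim k τ ⟨max_le hτ.1 hk', hτ.2⟩

/-! ## Consequences for the construction item -/

/-- **The wake is at most twice the amplitude anywhere in the wake zone**: for every profile of
`DyadicScalarFronts` with wake limit `L`, if `|t|·a(t) ≤ 1/(8Λ)` on `[τ_z, 0)` then `L ≤ 2a(τ)` for every
`τ ∈ [τ_z, 0)`. [cite: Tao2016AveragedNS, §1.2, §4; elementary] -/
theorem wake_le_two_mul (hε : 0 < ε₀) (hs : 1 < s)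
    (hode : ∀ t : ℝ, t < 0 → HasDerivAt a
      (bigLam ε₀ / s ^ 2 * a (t / s) ^ 2 - s / bigLam ε₀ * a t * a (s * t)) t)
    (hint : IntegrableOn a (Iio 0))
    (hbdd : ∃ t₀ : ℝ, t₀ < 0 ∧ ∃ P : ℝ, ∀ t : ℝ, t₀ ≤ t → t < 0 → |a t| ≤ P)
    {L : ℝ} (hL : Tendsto a (𝓝[<] 0) (𝓝 L))
    {τz : ℝ} (hτz : τz < 0) (hzone : ∀ t ∈ Ico τz 0, (-t) * a t ≤ 1 / (8 * bigLam ε₀))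
    {τ : ℝ} (hτ : τ ∈ Ico τz 0) : L ≤ 2 * a τ := by
  have hnn := nonneg_of_front hε hs hode hint hbdd
  obtain ⟨P, hP⟩ := bounded hε hs hode hint hbdd
  have h := wakeZone_le_two_mul hε hs hode hnn hP hτz hzone τ hτ
  refine le_of_tendsto hL ?_
  filter_upwards [Ico_mem_nhdsLT hτ.2] with t ht using h t ht

/-- **The wake zone is short**: under the same hypotheses `L·|τ| ≤ 1/(4Λ)` for every `τ` in the zone (so a
non-trivial front, `L > 0`, has `|τ_z| ≤ 1/(4ΛL)`). [cite: Tao2016AveragedNS, §1.2, §4; elementary] -/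
theorem wakeZone_short (hε : 0 < ε₀) (hs : 1 < s)
    (hode : ∀ t : ℝ, t < 0 → HasDerivAt a
      (bigLam ε₀ / s ^ 2 * a (t / s) ^ 2 - s / bigLam ε₀ * a t * a (s * t)) t)
    (hint : IntegrableOn a (Iio 0))
    (hbdd : ∃ t₀ : ℝ, t₀ < 0 ∧ ∃ P : ℝ, ∀ t : ℝ, t₀ ≤ t → t < 0 → |a t| ≤ P)
    {L : ℝ} (hL : Tendsto a (𝓝[<] 0) (𝓝 L))
    {τz : ℝ} (hτz : τz < 0) (hzone : ∀ t ∈ Ico τz 0, (-t) * a t ≤ 1 / (8 * bigLam ε₀))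
    {τ : ℝ} (hτ : τ ∈ Ico τz 0) : L * (-τ) ≤ 1 / (4 * bigLam ε₀) := by
  have hΛ : 0 < bigLam ε₀ := bigLam_pos (by linarith)
  have h := wake_le_two_mul hε hs hode hint hbdd hL hτz hzone hτ
  have hz := hzone τ hτ
  have hτ0 : 0 ≤ -τ := by linarith [hτ.2]
  calc L * (-τ) ≤ 2 * a τ * (-τ) := mul_le_mul_of_nonneg_right h hτ0
    _ = 2 * ((-τ) * a τ) := by ring
    _ ≤ 2 * (1 / (8 * bigLam ε₀)) := by linarith
    _ = 1 / (4 * bigLam ε₀) := by field_simp; norm_num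

/-- **The wake zone carries little action**: under the same hypotheses `∫_τ^0 a ≤ 2|τ|·a(τ) ≤ 1/(4Λ)` for every
`τ` in the zone. [cite: Tao2016AveragedNS, §1.2, §4; elementary] -/
theorem wakeZone_action_le (hε : 0 < ε₀) (hs : 1 < s)
    (hode : ∀ t : ℝ, t < 0 → HasDerivAt a
      (bigLam ε₀ / s ^ 2 * a (t / s) ^ 2 - s / bigLam ε₀ * a t * a (s * t)) t)
    (hint : IntegrableOn a (Iio 0))
    (hbdd : ∃ t₀ : ℝ, t₀ < 0 ∧ ∃ P : ℝ, ∀ t : ℝ, t₀ ≤ t → t < 0 → |a t| ≤ P)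
    {τz : ℝ} (hτz : τz < 0) (hzone : ∀ t ∈ Ico τz 0, (-t) * a t ≤ 1 / (8 * bigLam ε₀))
    {τ : ℝ} (hτ : τ ∈ Ico τz 0) :
    ∫ t in τ..0, a t ≤ 2 * ((-τ) * a τ) ∧ ∫ t in τ..0, a t ≤ 1 / (4 * bigLam ε₀) := by
  have hΛ : 0 < bigLam ε₀ := bigLam_pos (by linarith)
  have hnn := nonneg_of_front hε hs hode hint hbdd
  obtain ⟨P, hP⟩ := bounded hε hs hode hint hbdd
  have h := wakeZone_le_two_mul hε hs hode hnn hP hτz hzone τ hτ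
  have hIa : IntervalIntegrable a volume τ 0 := by
    rw [intervalIntegrable_iff_integrableOn_Ioo_of_le hτ.2.le]
    exact hint.mono_set fun u hu => hu.2
  have h1 : ∫ t in τ..0, a t ≤ ∫ t in τ..0, (2 * a τ : ℝ) :=
    intervalIntegral.integral_mono_on_of_le_Ioo hτ.2.le hIa intervalIntegrable_const
      fun t ht => h t ⟨ht.1.le, ht.2⟩
  rw [intervalIntegral.integral_const, smul_eq_mul] at h1
  have h2 : (0 - τ) * (2 * a τ) = 2 * ((-τ) * a τ) := by ring
  rw [h2] at h1
  refine ⟨h1, h1.trans ?_⟩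
  have hz := hzone τ hτ
  calc 2 * ((-τ) * a τ) ≤ 2 * (1 / (8 * bigLam ε₀)) := by linarith
    _ = 1 / (4 * bigLam ε₀) := by field_simp; norm_num

end WakeRatchetScalarFrontWakeZone

end Summit.NavierStokesRegularity.NavierStokesRegularity.Theorems

end
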